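import Literature.Probability.LatticeModels.CoarseCellMixingPeierls
import Literature.Probability.LatticeModels.CoarseCellMixingDefectsChain
import HarnessLib

/-!
# Coarse-cell mixing with defects, III: the one-step estimates of the block recursion

Eleventh companion ("theorems only") file of
`Literature/Probability/LatticeModels/CoarseCellFiniteSize.lean`, built on the chain rule with
defects (`CoarseCellMixingDefectsChain.multiCell_influence_good`): the two one-step estimates of
the Dobrushin–Shlosman block recursion when the finite-size condition `IsGoodFS` holds only for
GOOD exteriors and bad cells are Peierls-rare for the kernels (`UniformKernelPeierls`):

* `measureReal_kernel_existsBad_le`, `measureReal_kernel_compl_allGood_le` — under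
  `UniformKernelPeierls cell γ good q`, `γ_Λ(some cell of Y is bad | ζ) ≤ |Y| q` whenever the
  neighbours of `Y` are `Λ`-cells or good in `ζ` (union bound); `measurableSet_existsBad`,
  `measurableSet_allGood`; `mem_good_of_cell_empty` (at level `q < 1` empty cells are good);
* `fs_step_defects` — an observable of the cells `Y` whose values on `{Y good}` lie in an interval
  of length `ε` has influence `≤ ε |Y| δ + γ_Λ(Y not all good | ζ) + γ_Λ(Y not all good | ζ')`
  (the finite-size contraction step, with the bad-shell probabilities that a TV-type finite-size
  condition cannot avoid);
* `bounded_step_defects` — an observable of the cells `Y` of sup norm `≤ λ` has influence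
  `≤ 2λ |Y| δ + λ (γ_Λ(Y not all good | ζ) + γ_Λ(Y not all good | ζ'))` (the leak increments).

The recursion itself (exponential decay of boundary influence down to the defect density) is in
`CoarseCellMixingDefectsFloor.lean`.

## References

* R. L. Dobrushin, S. B. Shlosman, *Constructive criterion for the uniqueness of Gibbs field*
  (1985), §2.
* J. van den Berg, C. Maes, *Disagreement percolation in the study of Markov fields*,
  Ann. Probab. 22 (1994), §2 (rare open defects).
* H.-O. Georgii, *Gibbs Measures and Phase Transitions*, 2nd ed. (de Gruyter 2011), §8.2.
-/

noncomputable section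

open _root_.MeasureTheory
open scoped ENNReal

namespace Literature.Probability.LatticeModels

variable {d : ℕ} {μc : Fin d → ℕ} {V S : Type*} [MeasurableSpace S]

/-! ### Kernel bounds for bad cells under the kernel-uniform Peierls bound -/

omit [MeasurableSpace S] in
/-- The event "some cell of the finite set `Y` is bad" is measurable. [folklore] -/
theorem measurableSet_existsBad [MeasurableSpace (V → S)] {good : CoarseIdx μc → Set (V → S)}
    (hgm : ∀ c, MeasurableSet (good c)) (Y : Finset (CoarseIdx μc)) :
    MeasurableSet {σ : V → S | ∃ c ∈ Y, σ ∉ good c} := by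
  have h : {σ : V → S | ∃ c ∈ Y, σ ∉ good c} = ⋃ c ∈ Y, (good c)ᶜ := by
    ext σ; simp
  rw [h]
  exact Finset.measurableSet_biUnion Y fun c _ => (hgm c).compl

omit [MeasurableSpace S] in
/-- The event "every cell of the finite set `Y` is good" is measurable. [folklore] -/
theorem measurableSet_allGood [MeasurableSpace (V → S)] {good : CoarseIdx μc → Set (V → S)}
    (hgm : ∀ c, MeasurableSet (good c)) (Y : Finset (CoarseIdx μc)) :
    MeasurableSet {σ : V → S | ∀ c ∈ Y, σ ∈ good c} := by
  have h : {σ : V → S | ∀ c ∈ Y, σ ∈ good c} = ⋂ c ∈ Y, good c := by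
    ext σ; simp
  rw [h]
  exact Finset.measurableSet_biInter Y fun c _ => hgm c

/-- **Kernel probability of a bad cell in `Y`** under the kernel-uniform Peierls bound: if every
cell within coarse distance `1` of a cell of `Y` is either entirely resampled (a cell of the
cell-union `Λ`) or good in the exterior `ζ`, then `γ_Λ(some cell of Y is bad | ζ) ≤ |Y| · q`
(union bound over `Y` and `UniformKernelPeierls` on singletons). [folklore] -/
theorem measureReal_kernel_existsBad_le [Fintype V] {cell : V → CoarseIdx μc}
    {γ : Specification V S} {good : CoarseIdx μc → Set (V → S)}
    {q : ℝ} (hq : 0 ≤ q) (hUKP : UniformKernelPeierls cell γ good q) (Λ : Finset V)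
    (hΛ : ∀ v w, cell v = cell w → v ∈ Λ → w ∈ Λ) (ζ : V → S) (Y : Finset (CoarseIdx μc))
    (hY : ∀ c ∈ Y, ∀ c' : CoarseIdx μc, cdist c c' ≤ 1 → (∀ v, cell v = c' → v ∈ Λ) ∨ ζ ∈ good c') :
    (γ Λ ζ).real {σ | ∃ c ∈ Y, σ ∉ good c} ≤ Y.card * q := by
  set Bad : Set (V → S) := {σ | ∃ c ∈ Y, σ ∉ good c} with hBad
  have hsub : Bad ⊆ ⋃ c ∈ Y, {σ : V → S | ∀ e ∈ ({c} : Finset (CoarseIdx μc)), σ ∉ good e} := by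
    intro σ hσ
    obtain ⟨c, hc, hng⟩ := hσ
    simp only [Set.mem_iUnion, Set.mem_setOf_eq]
    refine ⟨c, hc, fun e he => ?_⟩
    rw [Finset.mem_singleton] at he
    subst he
    exact hng
  have h1 : γ Λ ζ Bad ≤
      ∑ c ∈ Y, γ Λ ζ {σ : V → S | ∀ e ∈ ({c} : Finset (CoarseIdx μc)), σ ∉ good e} :=
    (measure_mono hsub).trans (measure_biUnion_finset_le Y _)
  have h2 : ∑ c ∈ Y, γ Λ ζ {σ : V → S | ∀ e ∈ ({c} : Finset (CoarseIdx μc)), σ ∉ good e} ≤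
      ∑ c ∈ Y, ENNReal.ofReal q :=
    Finset.sum_le_sum fun c hc => by
      have h := hUKP Λ hΛ ζ {c} fun e he c' hcc' => by
        rw [Finset.mem_singleton] at he
        subst he
        exact hY e hc c' hcc'
      simpa using h
  have h3 : ∑ c ∈ Y, ENNReal.ofReal q = (Y.card : ℝ≥0∞) * ENNReal.ofReal q := by
    rw [Finset.sum_const, nsmul_eq_mul]
  have hne : (Y.card : ℝ≥0∞) * ENNReal.ofReal q ≠ ∞ :=
    ENNReal.mul_ne_top (ENNReal.natCast_ne_top _) ENNReal.ofReal_ne_top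
  calc (γ Λ ζ).real Bad = (γ Λ ζ Bad).toReal := measureReal_def _ _
    _ ≤ ((Y.card : ℝ≥0∞) * ENNReal.ofReal q).toReal :=
        ENNReal.toReal_mono hne (h1.trans (h2.trans h3.le))
    _ = Y.card * q := by
        rw [ENNReal.toReal_mul, ENNReal.toReal_natCast, ENNReal.toReal_ofReal hq]

/-- **Kernel probability that a cell of `Y` is bad, complement form**: under the hypotheses of
`measureReal_kernel_existsBad_le`, `γ_Λ({all cells of Y good}ᶜ | ζ) ≤ |Y| · q`. [folklore] -/
theorem measureReal_kernel_compl_allGood_le [Fintype V] {cell : V → CoarseIdx μc}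
    {γ : Specification V S} {good : CoarseIdx μc → Set (V → S)}
    {q : ℝ} (hq : 0 ≤ q) (hUKP : UniformKernelPeierls cell γ good q) (Λ : Finset V)
    (hΛ : ∀ v w, cell v = cell w → v ∈ Λ → w ∈ Λ) (ζ : V → S) (Y : Finset (CoarseIdx μc))
    (hY : ∀ c ∈ Y, ∀ c' : CoarseIdx μc, cdist c c' ≤ 1 → (∀ v, cell v = c' → v ∈ Λ) ∨ ζ ∈ good c') :
    (γ Λ ζ).real {σ | ∀ c ∈ Y, σ ∈ good c}ᶜ ≤ Y.card * q := by
  have h : {σ : V → S | ∀ c ∈ Y, σ ∈ good c}ᶜ = {σ | ∃ c ∈ Y, σ ∉ good c} := by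
    ext σ; simp
  rw [h]
  exact measureReal_kernel_existsBad_le hq hUKP Λ hΛ ζ Y hY

/-! ### The two one-step estimates of the block recursion with defects -/

omit [MeasurableSpace S] in
/-- The all-good event of the cells `Y` is `Y`-local (cell-locality of `good`). [folklore] -/
theorem mem_allGood_iff_of_agree {cell : V → CoarseIdx μc} {good : CoarseIdx μc → Set (V → S)}
    (hgl : ∀ (c : CoarseIdx μc) (σ τ : V → S), (∀ v, cell v = c → σ v = τ v) →
      (σ ∈ good c ↔ τ ∈ good c))
    (Y : Finset (CoarseIdx μc)) {σ τ : V → S} (h : ∀ v, cell v ∈ Y → σ v = τ v) :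
    σ ∈ {σ : V → S | ∀ y ∈ Y, σ ∈ good y} ↔ τ ∈ {σ : V → S | ∀ y ∈ Y, σ ∈ good y} := by
  simp only [Set.mem_setOf_eq]
  exact forall₂_congr fun y hy => hgl y σ τ fun v hv => h v (hv ▸ hy)

/-- **The finite-size step with defects.** Under the single-cell hypothesis of
`multiCell_influence_good` (influence `≤ δ` for boundary conditions agreeing within `ρ` and good
on the frozen cells within `ρ'`), let `H` be a `[0,1]`-valued measurable observable of the cells
`Y` all of whose values on the event `G = {all cells of Y good}` lie within `ε` of each other.
Then for boundary conditions agreeing and good near the cells of `Y`,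
`|γ_Λ H(ζ) - γ_Λ H(ζ')| ≤ ε |Y| δ + γ_Λ(Gᶜ | ζ) + γ_Λ(Gᶜ | ζ')`: write `H = c₀ + ε H̃ + R₀`
with `c₀` the infimum of `H` on `G`, `H̃ = 1_G (H - c₀)/ε ∈ [0,1]` a `Y`-local observable vanishing
off `G` (chain rule with defects) and `|R₀| ≤ 1_{Gᶜ}`. This is the contraction step of the
Dobrushin–Shlosman block recursion when the finite-size condition holds only for good exteriors.
[cite: DobrushinShlosman1985, §2] -/
theorem fs_step_defects [Fintype V] {cell : V → CoarseIdx μc}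
    {γ : Specification V S} (hγ : IsSpecification γ) {good : CoarseIdx μc → Set (V → S)}
    (hgl : ∀ (c : CoarseIdx μc) (σ τ : V → S), (∀ v, cell v = c → σ v = τ v) →
      (σ ∈ good c ↔ τ ∈ good c))
    (hgm : ∀ c, MeasurableSet (good c)) {ρ ρ' : ℕ} {δ : ℝ} (hδ : 0 ≤ δ)
    (hR : ∀ (Λ : Finset V), (∀ v w, cell v = cell w → v ∈ Λ → w ∈ Λ) →
      ∀ (x : CoarseIdx μc) (g : (V → S) → ℝ), Measurable g → (∀ σ, 0 ≤ g σ ∧ g σ ≤ 1) →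
      DependsOn g {v | cell v = x} →
      ∀ ζ ζ' : V → S, (∀ v, v ∉ Λ → cdist x (cell v) ≤ ρ → ζ v = ζ' v) →
        (∀ v, v ∉ Λ → cdist x (cell v) ≤ ρ' → ζ ∈ good (cell v) ∧ ζ' ∈ good (cell v)) →
        |∫ σ, g σ ∂(γ Λ ζ) - ∫ σ, g σ ∂(γ Λ ζ')| ≤ δ)
    (Y : Finset (CoarseIdx μc)) (Λ : Finset V) (hΛ : ∀ v w, cell v = cell w → v ∈ Λ → w ∈ Λ)
    (H : (V → S) → ℝ) (hHm : Measurable H) (hH01 : ∀ σ, 0 ≤ H σ ∧ H σ ≤ 1)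
    (hHdep : DependsOn H {v | cell v ∈ Y}) {ε : ℝ} (hε : 0 ≤ ε)
    (hosc : ∀ σ₁ σ₂, (∀ y ∈ Y, σ₁ ∈ good y) → (∀ y ∈ Y, σ₂ ∈ good y) → |H σ₁ - H σ₂| ≤ ε)
    (ζ ζ' : V → S) (hagree : ∀ y ∈ Y, ∀ v, v ∉ Λ → cdist y (cell v) ≤ ρ → ζ v = ζ' v)
    (hgood : ∀ y ∈ Y, ∀ v, v ∉ Λ → cdist y (cell v) ≤ ρ' →
      ζ ∈ good (cell v) ∧ ζ' ∈ good (cell v)) :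
    |∫ σ, H σ ∂(γ Λ ζ) - ∫ σ, H σ ∂(γ Λ ζ')| ≤
      ε * (Y.card * δ) + (γ Λ ζ).real {σ | ∀ y ∈ Y, σ ∈ good y}ᶜ +
        (γ Λ ζ').real {σ | ∀ y ∈ Y, σ ∈ good y}ᶜ := by
  classical
  haveI := hγ.isProbability Λ ζ
  haveI := hγ.isProbability Λ ζ'
  set G : Set (V → S) := {σ | ∀ y ∈ Y, σ ∈ good y} with hGdef
  have hGm : MeasurableSet G := measurableSet_allGood hgm Y
  -- the infimum of `H` on the good event
  have hbdd : BddBelow (H '' G) := ⟨0, by rintro _ ⟨σ, -, rfl⟩; exact (hH01 σ).1⟩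
  set c₀ : ℝ := if (H '' G).Nonempty then sInf (H '' G) else 0 with hc₀
  have hc₀le : ∀ σ ∈ G, c₀ ≤ H σ := fun σ hσ => by
    have hne : (H '' G).Nonempty := ⟨H σ, σ, hσ, rfl⟩
    rw [hc₀, if_pos hne]
    exact csInf_le hbdd ⟨σ, hσ, rfl⟩
  have hlec₀ : ∀ σ ∈ G, H σ ≤ c₀ + ε := fun σ hσ => by
    have hne : (H '' G).Nonempty := ⟨H σ, σ, hσ, rfl⟩
    rw [hc₀, if_pos hne]
    have h : H σ - ε ≤ sInf (H '' G) := le_csInf hne (by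
      rintro _ ⟨σ₂, hσ₂, rfl⟩
      have h2 := abs_sub_le_iff.1 (hosc σ σ₂ hσ hσ₂)
      linarith [h2.1])
    linarith
  have hc₀0 : 0 ≤ c₀ := by
    rw [hc₀]
    split_ifs with hne
    · exact le_csInf hne (by rintro _ ⟨σ, -, rfl⟩; exact (hH01 σ).1)
    · exact le_rfl
  have hc₀1 : c₀ ≤ 1 := by
    rw [hc₀]
    split_ifs with hne
    · obtain ⟨_, σ, hσ, rfl⟩ := hne
      exact (csInf_le hbdd ⟨σ, hσ, rfl⟩).trans (hH01 σ).2
    · exact zero_le_one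
  -- the normalised observable and the remainder
  set Ht : (V → S) → ℝ := G.indicator fun σ => (H σ - c₀) / ε with hHt
  set R₀ : (V → S) → ℝ := fun σ => H σ - c₀ - ε * Ht σ with hR₀
  have hHtm : Measurable Ht := ((hHm.sub_const c₀).div_const ε).indicator hGm
  have hHt01 : ∀ σ, 0 ≤ Ht σ ∧ Ht σ ≤ 1 := fun σ => by
    by_cases hσ : σ ∈ G
    · rw [hHt, Set.indicator_of_mem hσ]
      rcases hε.eq_or_lt with hε0 | hεpos
      · rw [← hε0, div_zero]; exact ⟨le_rfl, zero_le_one⟩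
      · exact ⟨div_nonneg (by linarith [hc₀le σ hσ]) hε,
          (div_le_one hεpos).2 (by linarith [hlec₀ σ hσ])⟩
    · rw [hHt, Set.indicator_of_notMem hσ]; exact ⟨le_rfl, zero_le_one⟩
  have hHtdep : DependsOn Ht {v | cell v ∈ Y} := by
    intro σ τ h
    have hG : σ ∈ G ↔ τ ∈ G := mem_allGood_iff_of_agree hgl Y h
    by_cases hσ : σ ∈ G
    · rw [hHt, Set.indicator_of_mem hσ, Set.indicator_of_mem (hG.1 hσ), hHdep h]
    · rw [hHt, Set.indicator_of_notMem hσ, Set.indicator_of_notMem (fun hτ => hσ (hG.2 hτ))]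
  have hHt0 : ∀ σ, (∃ y ∈ Y, σ ∉ good y) → Ht σ = 0 := by
    rintro σ ⟨y, hy, hσy⟩
    have hσG : σ ∉ G := fun hσ => hσy (hσ y hy)
    rw [hHt, Set.indicator_of_notMem hσG]
  have hR₀G : ∀ σ ∈ G, R₀ σ = 0 := fun σ hσ => by
    simp only [hR₀, hHt, Set.indicator_of_mem hσ]
    rcases hε.eq_or_lt with hε0 | hεpos
    · have : H σ = c₀ := le_antisymm (by linarith [hlec₀ σ hσ, hε0]) (hc₀le σ hσ)
      rw [this, ← hε0]; ring
    · field_simp; ring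
  have hR₀b : ∀ σ, |R₀ σ| ≤ Gᶜ.indicator (1 : (V → S) → ℝ) σ := fun σ => by
    by_cases hσ : σ ∈ G
    · rw [hR₀G σ hσ, abs_zero, Set.indicator_of_notMem (Set.notMem_compl_iff.2 hσ)]
    · rw [Set.indicator_of_mem (Set.mem_compl hσ), Pi.one_apply]
      simp only [hR₀, hHt, Set.indicator_of_notMem hσ, mul_zero, sub_zero]
      rw [abs_sub_le_iff]
      constructor <;> linarith [(hH01 σ).1, (hH01 σ).2]
  have hR₀m : Measurable R₀ := (hHm.sub_const c₀).sub (hHtm.const_mul ε)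
  -- decomposition of the expectations
  have hHti : ∀ η, Integrable Ht (γ Λ η) := fun η => by
    haveI := hγ.isProbability Λ η
    exact DobrushinMetric.integrable_of_abs_le' hHtm (M := 1) fun σ => by
      rw [abs_of_nonneg (hHt01 σ).1]; exact (hHt01 σ).2
  have hR₀i : ∀ η, Integrable R₀ (γ Λ η) := fun η => by
    haveI := hγ.isProbability Λ η
    exact DobrushinMetric.integrable_of_abs_le' hR₀m (M := 1) fun σ => (hR₀b σ).trans (by
      by_cases h : σ ∈ Gᶜ <;> simp [h])
  have hdec : ∀ (η : V → S), ∫ σ, H σ ∂(γ Λ η) =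
      c₀ + ε * ∫ σ, Ht σ ∂(γ Λ η) + ∫ σ, R₀ σ ∂(γ Λ η) := by
    intro η
    haveI := hγ.isProbability Λ η
    have h2 : Integrable (fun σ => ε * Ht σ) (γ Λ η) := (hHti η).const_mul ε
    have h1 : Integrable (fun σ => c₀ + ε * Ht σ) (γ Λ η) := (integrable_const c₀).add h2
    have e1 : ∫ σ, H σ ∂(γ Λ η) = ∫ σ, ((c₀ + ε * Ht σ) + R₀ σ) ∂(γ Λ η) :=
      integral_congr_ae (ae_of_all _ fun σ => by simp only [hR₀]; ring)
    rw [e1, integral_add h1 (hR₀i η), integral_add (integrable_const c₀) h2, integral_const_mul,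
      integral_const]
    simp
  have hR₀int : ∀ (η : V → S), |∫ σ, R₀ σ ∂(γ Λ η)| ≤ (γ Λ η).real Gᶜ := by
    intro η
    haveI := hγ.isProbability Λ η
    calc |∫ σ, R₀ σ ∂(γ Λ η)| ≤ ∫ σ, |R₀ σ| ∂(γ Λ η) := abs_integral_le_integral_abs
      _ ≤ ∫ σ, Gᶜ.indicator (1 : (V → S) → ℝ) σ ∂(γ Λ η) :=
          integral_mono (hR₀i η).abs ((integrable_const (1 : ℝ)).indicator hGm.compl) hR₀b
      _ = (γ Λ η).real Gᶜ := integral_indicator_one hGm.compl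
  have hchain := multiCell_influence_good hγ hgl hδ hR Y Λ hΛ Ht hHtm hHt01 hHtdep hHt0 ζ ζ' hagree
    hgood
  rw [hdec ζ, hdec ζ']
  calc |c₀ + ε * ∫ σ, Ht σ ∂(γ Λ ζ) + ∫ σ, R₀ σ ∂(γ Λ ζ) -
        (c₀ + ε * ∫ σ, Ht σ ∂(γ Λ ζ') + ∫ σ, R₀ σ ∂(γ Λ ζ'))|
      = |ε * (∫ σ, Ht σ ∂(γ Λ ζ) - ∫ σ, Ht σ ∂(γ Λ ζ')) +
          (∫ σ, R₀ σ ∂(γ Λ ζ) - ∫ σ, R₀ σ ∂(γ Λ ζ'))| := by ring_nf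
    _ ≤ |ε * (∫ σ, Ht σ ∂(γ Λ ζ) - ∫ σ, Ht σ ∂(γ Λ ζ'))| +
          |∫ σ, R₀ σ ∂(γ Λ ζ) - ∫ σ, R₀ σ ∂(γ Λ ζ')| := abs_add_le _ _
    _ ≤ ε * (Y.card * δ) + ((γ Λ ζ).real Gᶜ + (γ Λ ζ').real Gᶜ) := by
        refine add_le_add ?_ ((abs_sub _ _).trans (add_le_add (hR₀int ζ) (hR₀int ζ')))
        rw [abs_mul, abs_of_nonneg hε]
        exact mul_le_mul_of_nonneg_left hchain hε
    _ = _ := by ring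

/-- **The bounded step with defects.** Under the single-cell hypothesis of
`multiCell_influence_good`, a measurable observable `H` of the cells `Y` with `|H| ≤ λ` has, for
boundary conditions agreeing and good near the cells of `Y`, influence
`≤ 2λ |Y| δ + λ (γ_Λ(Gᶜ | ζ) + γ_Λ(Gᶜ | ζ'))`, `G = {all cells of Y good}`: split
`H = H 1_G + H 1_{Gᶜ}`; the first part vanishes off `G` (chain rule with defects), the second has
expectation `≤ λ γ_Λ(Gᶜ | ·)` under either kernel (the leak increments of the recursion).
[folklore] -/
theorem bounded_step_defects [Fintype V] {cell : V → CoarseIdx μc}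
    {γ : Specification V S} (hγ : IsSpecification γ) {good : CoarseIdx μc → Set (V → S)}
    (hgl : ∀ (c : CoarseIdx μc) (σ τ : V → S), (∀ v, cell v = c → σ v = τ v) →
      (σ ∈ good c ↔ τ ∈ good c))
    (hgm : ∀ c, MeasurableSet (good c)) {ρ ρ' : ℕ} {δ : ℝ} (hδ : 0 ≤ δ)
    (hR : ∀ (Λ : Finset V), (∀ v w, cell v = cell w → v ∈ Λ → w ∈ Λ) →
      ∀ (x : CoarseIdx μc) (g : (V → S) → ℝ), Measurable g → (∀ σ, 0 ≤ g σ ∧ g σ ≤ 1) →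
      DependsOn g {v | cell v = x} →
      ∀ ζ ζ' : V → S, (∀ v, v ∉ Λ → cdist x (cell v) ≤ ρ → ζ v = ζ' v) →
        (∀ v, v ∉ Λ → cdist x (cell v) ≤ ρ' → ζ ∈ good (cell v) ∧ ζ' ∈ good (cell v)) →
        |∫ σ, g σ ∂(γ Λ ζ) - ∫ σ, g σ ∂(γ Λ ζ')| ≤ δ)
    (Y : Finset (CoarseIdx μc)) (Λ : Finset V) (hΛ : ∀ v w, cell v = cell w → v ∈ Λ → w ∈ Λ)
    (H : (V → S) → ℝ) (hHm : Measurable H) {lam : ℝ} (hHb : ∀ σ, |H σ| ≤ lam)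
    (hHdep : DependsOn H {v | cell v ∈ Y})
    (ζ ζ' : V → S) (hagree : ∀ y ∈ Y, ∀ v, v ∉ Λ → cdist y (cell v) ≤ ρ → ζ v = ζ' v)
    (hgood : ∀ y ∈ Y, ∀ v, v ∉ Λ → cdist y (cell v) ≤ ρ' →
      ζ ∈ good (cell v) ∧ ζ' ∈ good (cell v)) :
    |∫ σ, H σ ∂(γ Λ ζ) - ∫ σ, H σ ∂(γ Λ ζ')| ≤
      2 * lam * (Y.card * δ) + lam * ((γ Λ ζ).real {σ | ∀ y ∈ Y, σ ∈ good y}ᶜ +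
        (γ Λ ζ').real {σ | ∀ y ∈ Y, σ ∈ good y}ᶜ) := by
  classical
  haveI := hγ.isProbability Λ ζ
  haveI := hγ.isProbability Λ ζ'
  have hlam : 0 ≤ lam := (abs_nonneg _).trans (hHb ζ)
  set G : Set (V → S) := {σ | ∀ y ∈ Y, σ ∈ good y} with hGdef
  have hGm : MeasurableSet G := measurableSet_allGood hgm Y
  set H₁ : (V → S) → ℝ := G.indicator H with hH₁
  set H₂ : (V → S) → ℝ := Gᶜ.indicator H with hH₂
  have hH₁m : Measurable H₁ := hHm.indicator hGm
  have hH₂m : Measurable H₂ := hHm.indicator hGm.compl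
  have hH₁b : ∀ σ, |H₁ σ| ≤ lam := fun σ => by
    by_cases h : σ ∈ G
    · rw [hH₁, Set.indicator_of_mem h]; exact hHb σ
    · rw [hH₁, Set.indicator_of_notMem h, abs_zero]; exact hlam
  have hH₂b : ∀ σ, |H₂ σ| ≤ lam * Gᶜ.indicator (1 : (V → S) → ℝ) σ := fun σ => by
    by_cases h : σ ∈ Gᶜ
    · rw [hH₂, Set.indicator_of_mem h, Set.indicator_of_mem h, Pi.one_apply, mul_one]
      exact hHb σ
    · rw [hH₂, Set.indicator_of_notMem h, Set.indicator_of_notMem h, abs_zero, mul_zero]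
  have hH₁dep : DependsOn H₁ {v | cell v ∈ Y} := by
    intro σ τ h
    have hG : σ ∈ G ↔ τ ∈ G := mem_allGood_iff_of_agree hgl Y h
    by_cases hσ : σ ∈ G
    · rw [hH₁, Set.indicator_of_mem hσ, Set.indicator_of_mem (hG.1 hσ), hHdep h]
    · rw [hH₁, Set.indicator_of_notMem hσ, Set.indicator_of_notMem (fun hτ => hσ (hG.2 hτ))]
  have hH₁0 : ∀ σ, (∃ y ∈ Y, σ ∉ good y) → H₁ σ = 0 := by
    rintro σ ⟨y, hy, hσy⟩
    have hσG : σ ∉ G := fun hσ => hσy (hσ y hy)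
    rw [hH₁, Set.indicator_of_notMem hσG]
  have hsplit : ∀ σ, H σ = H₁ σ + H₂ σ := fun σ => by
    rw [hH₁, hH₂]; exact (Set.indicator_self_add_compl_apply G H σ).symm
  have hH₁i : ∀ η, Integrable H₁ (γ Λ η) := fun η => by
    haveI := hγ.isProbability Λ η
    exact DobrushinMetric.integrable_of_abs_le' hH₁m hH₁b
  have hH₂i : ∀ η, Integrable H₂ (γ Λ η) := fun η => by
    haveI := hγ.isProbability Λ η
    exact DobrushinMetric.integrable_of_abs_le' hH₂m (M := lam) fun σ => (hH₂b σ).trans (by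
      by_cases h : σ ∈ Gᶜ
      · simp [h]
      · simp [h, hlam])
  have hdec : ∀ (η : V → S), ∫ σ, H σ ∂(γ Λ η) = ∫ σ, H₁ σ ∂(γ Λ η) + ∫ σ, H₂ σ ∂(γ Λ η) := by
    intro η
    rw [← integral_add (hH₁i η) (hH₂i η)]
    exact integral_congr_ae (ae_of_all _ hsplit)
  have hH₂int : ∀ (η : V → S), |∫ σ, H₂ σ ∂(γ Λ η)| ≤ lam * (γ Λ η).real Gᶜ := by
    intro η
    haveI := hγ.isProbability Λ η
    calc |∫ σ, H₂ σ ∂(γ Λ η)| ≤ ∫ σ, |H₂ σ| ∂(γ Λ η) := abs_integral_le_integral_abs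
      _ ≤ ∫ σ, lam * Gᶜ.indicator (1 : (V → S) → ℝ) σ ∂(γ Λ η) :=
          integral_mono (hH₂i η).abs (((integrable_const (1 : ℝ)).indicator hGm.compl).const_mul
            lam) hH₂b
      _ = lam * (γ Λ η).real Gᶜ := by rw [integral_const_mul, integral_indicator_one hGm.compl]
  have hchain := multiCell_influence_good_of_abs_le hγ hgl hδ hR Y Λ hΛ H₁ hH₁m hH₁b hH₁dep hH₁0
    ζ ζ' hagree hgood
  rw [hdec ζ, hdec ζ']
  calc |∫ σ, H₁ σ ∂(γ Λ ζ) + ∫ σ, H₂ σ ∂(γ Λ ζ) - (∫ σ, H₁ σ ∂(γ Λ ζ') + ∫ σ, H₂ σ ∂(γ Λ ζ'))|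
      = |(∫ σ, H₁ σ ∂(γ Λ ζ) - ∫ σ, H₁ σ ∂(γ Λ ζ')) +
          (∫ σ, H₂ σ ∂(γ Λ ζ) - ∫ σ, H₂ σ ∂(γ Λ ζ'))| := by ring_nf
    _ ≤ |∫ σ, H₁ σ ∂(γ Λ ζ) - ∫ σ, H₁ σ ∂(γ Λ ζ')| +
          |∫ σ, H₂ σ ∂(γ Λ ζ) - ∫ σ, H₂ σ ∂(γ Λ ζ')| := abs_add_le _ _
    _ ≤ 2 * lam * (Y.card * δ) + (lam * (γ Λ ζ).real Gᶜ + lam * (γ Λ ζ').real Gᶜ) :=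
        add_le_add hchain ((abs_sub _ _).trans (add_le_add (hH₂int ζ) (hH₂int ζ')))
    _ = _ := by ring

/-- **Empty cells are good** under a kernel-uniform Peierls bound at level `q < 1`: if no site is
labelled by the cell `c`, then goodness at `c` does not depend on the configuration (cell-locality,
vacuously), and `UniformKernelPeierls` on the singleton `{c}` in the full volume bounds the kernel
probability of `{c bad}` — which would be everything — by `q < 1`. [folklore] -/
theorem mem_good_of_cell_empty [Fintype V] {cell : V → CoarseIdx μc} {γ : Specification V S}
    (hγ : IsSpecification γ) {good : CoarseIdx μc → Set (V → S)}
    (hgl : ∀ (c : CoarseIdx μc) (σ τ : V → S), (∀ v, cell v = c → σ v = τ v) →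
      (σ ∈ good c ↔ τ ∈ good c))
    {q : ℝ} (hq1 : q < 1) (hUKP : UniformKernelPeierls cell γ good q) (c : CoarseIdx μc)
    (hc : ∀ v, cell v ≠ c) (σ : V → S) : σ ∈ good c := by
  by_contra hσ
  have hall : ∀ τ : V → S, τ ∉ good c := fun τ hτ =>
    hσ ((hgl c σ τ fun v hv => absurd hv (hc v)).2 hτ)
  have huniv : {τ : V → S | ∀ e ∈ ({c} : Finset (CoarseIdx μc)), τ ∉ good e} = Set.univ := by
    ext τ
    simp only [Finset.mem_singleton, forall_eq, Set.mem_setOf_eq, Set.mem_univ, iff_true]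
    exact hall τ
  have h := hUKP Finset.univ (fun _ _ _ _ => Finset.mem_univ _) σ {c}
    (fun _ _ _ _ => Or.inl fun v _ => Finset.mem_univ v)
  haveI := hγ.isProbability Finset.univ σ
  rw [huniv, measure_univ, Finset.card_singleton, pow_one] at h
  have h1 : (1 : ℝ) ≤ q := by
    have h' := ENNReal.toReal_mono ENNReal.ofReal_ne_top h
    rwa [ENNReal.toReal_one, ENNReal.toReal_ofReal (by linarith [(ENNReal.one_le_ofReal).1 h])]
      at h'
  linarith

end Literature.Probability.LatticeModels
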